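import Summits.ValiantsHypothesis.ValiantsHypothesis.Theorems.NewtonUnitEquationsTwoProductsRankOneThreeGenLawCount
import HarnessLib

/-!
# Route NewtonUnitEquations — crux `TwoProducts` (stmt-ValiantsHypothesis-5906), line `relation_ladder`, rung R7b (rank one on THREE
# letters, ALL coefficient patterns `p•α = q•β + r•γ`) + rung R7c (TWO letters with torsion): the DILATED FREE LIFT — part 7/7 — the laws `rankOneThreeGenLaw_proof` (R7b) and `rankOneTwoLaw_proof` (R7c), with the instance corollaries (T8 end)

(T8, end) `rankOneThreeGenLaw_proof` (literal body of `RankOneThreeGenLaw`), the instance corollaries `visible_bound_free` (p = 1, R7a) and `visible_bound_hom` (p = q + r, R6d; via `R6c.rankOneCoincidences_symm`), the two-letter tools `exists_tuple_of_mem_support_tailDiff` / `card_le_of_subset_pair`, and `rankOneTwoLaw_proof` (literal body of `RankOneTwoLaw`).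

val-idea-8 g3 (ideator; lens decomp), 2026-08-28.  THE GENERAL THREE-LETTER RANK-ONE LAW `p•α = q•β + r•γ` (all `p, q ≥ 1`, `r ≥ 0`):
lift `α ↦ Y_b^q Y_c^r, β ↦ Y_b^p, γ ↦ Y_c^p` over the `p`-DILATED plane (`enumP : b ↦ β, c ↦ γ, i ↦ p•enum i`), fibres `k` with divisibility
guards `p ∣ x_b − qk`, `p ∣ x_c − rk`, letter count `B_k = k + (x_b−qk)/p + (x_c−rk)/p`, DOUBLE SLICING `(b₁, b₂) = (x_b, x_c)`, the coefficient
theorem with `Pfac · C(R + B_k − 1, B_k) · κ_k`, finite SHIFT RANK and val-lit-p3's `ShiftRank.pencilCount` BY NAME; large or absent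
coefficients/letters are permutation type (R3♯).  Instances: R6b (1;1,1), R6c (2;1,1), R7a (p = 1, `visible_bound_free`), R6d = val-lit-p3's
homogeneous shape (p = q + r, `visible_bound_hom`), and rung R7c = rank one on TWO letters with torsion `p•α = q•β` (`r = 0`, idle third letter).

PORT NOTE (val-lit-p3 g15, prover seat, helper mode `--supports stmt-ValiantsHypothesis-5906 --as helper`, no stub credit claimed; the author's
request val-width INBOX 12:15Z/12:19Z + desk RULING #279 (c)): part 7/7 of a VERBATIM Theorems-side port of val-idea-8 g3's sorry-free module
`Cruxes/TwoProducts/Lines/relation_ladder_R7b.lean` REV 2 (tree sha256 f9e10d1fedcbd387…; 1 890 lines; `lean check` rc 0, 0 sorries,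
0 warnings, axioms standard).  ALL mathematics and ALL proofs are val-idea-8 g3's.  Port changes only: (i) file split + import chain;
(ii) declarations re-declared verbatim from LANDED ports are referenced BY NAME instead — `R6b.sum_sgn`, `R6b.HSD` (+ six closure
lemmas), `R6b.hsd_binChar` (R6b port); `tab`, `sgn`, `toolBound_mono` (R6 port, parent namespace); `R7a.SIdx`, `R7a.card_SIdx`,
`R7a.msetT_apply_le`, `R7a.permType_of_rankOne_largeCoeff`, `R7a.permType_of_rankOne_absent` (R7a port); `rankOne_symm` =
`R6c.rankOneCoincidences_symm` (R6c); `wt_nsmul'` = `FormalLogLinearisation.wt_nsmul`; (iii) section variables α-renamed `I ↦ Ig`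
(QIdx datum), `D ↦ Dg` (RelData datum) — forced by the gate's textual statement index (`dedup.landed`), since the R6b / R7a ports own
same-text lemmas over `ThreeIdx` / `QIdx`; (iv) docstrings on API lemmas; (v) in part 7/7 the parameter-free `def RankOneThreeGenLaw : Prop`
and `def RankOneTwoLaw : Prop` are NOT declared (relocation rule) — the laws are stated by their LITERAL bodies as `rankOneThreeGenLaw_proof`
and `rankOneTwoLaw_proof`; `visible_bound_free` / `visible_bound_hom` keep their names and texts.  Namespace = the author's
(`…PermutationType.R7b`).  Nothing here closes the line's residual, the crux `TwoProducts` (5906) or `VP ≠ VNP`; no summit statement is proved.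

Honest scope (the author's): rank one on FOUR letters with general coefficients, relations on ≥ 5 letters, one-sided `p•α = Σ qᵢ βᵢ` (R8, memo
only) and coincidence rank ≥ 2 are NOT covered here.  Nothing here moves VP ≠ VNP; `TwoProducts` (5906) stays OPEN. [folklore]
-/

noncomputable section

-- Sub = Summit single-conjunct layout: the duplicated namespace component is mandated by the tree.
set_option linter.dupNamespace false
set_option linter.unusedSimpArgs false
set_option linter.deprecated false
set_option linter.unusedSectionVars false
set_option linter.unusedVariables false
set_option linter.unnecessarySeqFocus false

namespace Summit.ValiantsHypothesis.ValiantsHypothesis.Theorems.NewtonUnitEquations.TwoProducts.PermutationType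
namespace R7b
open scoped BigOperators
open MvPolynomial

variable {σ : Type*} [Fintype σ] [DecidableEq σ]

variable (Ig : QIdx σ)

section FreeCount
open Summit.ValiantsHypothesis.ValiantsHypothesis.Theorems.NewtonUnitEquations.TwoProducts.FormalLogLinearisation
open Summit.ValiantsHypothesis.ValiantsHypothesis.Theorems.NewtonUnitEquations.TwoProducts.PlanarCell

variable {m : ℕ} {u v : Fin m → MvPolynomial (Fin 2) ℂ} (Dg : RelData u v)


omit [Fintype σ] [DecidableEq σ] in
/-- **R7b — THE GENERAL THREE-LETTER RANK-ONE LAW, UNCONDITIONAL** (val-idea-8 g3's `rankOneThreeGenLaw : RankOneThreeGenLaw`).  If ALL additive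
coincidences of the letter family come from ONE relation `p α = q β + r γ` (`p, q, r ≥ 1`) among distinct letters (rank-one coincidence lattice),
then GLOBALLY `#visible ≤ 2^{c m} (#T + 2)^c`; `p = 1` is R7a, `(1;1,1)` R6b, `(2;1,1)` R6c (letters renamed), `p = q + r` R6d.  PORT DELTA
(val-lit-p3 g15): the source's parameter-free `def RankOneThreeGenLaw : Prop` is relocated by the gate, so the law is stated by its LITERAL
body (a line file wires its own def against this theorem by `exact`).  Nothing here closes the residual of the line, the crux `TwoProducts`
(5906) or `VP ≠ VNP`. [folklore] -/
theorem rankOneThreeGenLaw_proof :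
  ∃ c : ℕ, ∀ (m : ℕ) (u v : Fin m → MvPolynomial (Fin 2) ℂ), (∀ j, coeff 0 (u j) = 0) → (∀ j, coeff 0 (v j) = 0) →
    (∃ (α β γ : Expo) (p q r : ℕ), 1 ≤ p ∧ 1 ≤ q ∧ 1 ≤ r ∧ α ≠ β ∧ α ≠ γ ∧ β ≠ γ ∧ p • α = q • β + r • γ ∧
      RankOneCoincidences (fun j => (u j).support ∪ (v j).support)
        (Finsupp.single β q + Finsupp.single γ r) (Finsupp.single α p)) →
    ∀ S : Finset Expo, (∀ l ∈ S, ∃ ξ : Fin 2 → ℝ, ValidWeight u v ξ ∧ IsStrictTop ξ ↑(tailDiff u v).support l) →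
      S.card ≤ 2 ^ (c * m) * ((tailSupport u v).card + 2) ^ c := by

  classical
  obtain ⟨c, hc1, hc2⟩ := arith_R7b
  refine ⟨c, fun m u v hu hv hrel S hS => ?_⟩
  obtain ⟨α, β, γ, p, q, r, hp, hq, hr, hab, hac, hbc, hrel, hR⟩ := hrel
  rcases S.eq_empty_or_nonempty with hSe | hSne
  · simp [hSe]
  obtain ⟨l₀, hl₀⟩ := hSne
  obtain ⟨ξ₀, hval₀, htop₀⟩ := hS l₀ hl₀
  have hm : 1 ≤ m := by
    rcases Nat.eq_zero_or_pos m with h | h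
    · exfalso
      subst h
      apply mem_support_iff.mp htop₀.1
      unfold tailDiff
      simp
    · exact h
  -- evaluations of the relation sides at the three letters
  have hρpα : (Finsupp.single β q + Finsupp.single γ r) α = 0 := by
    simp [Finsupp.single_apply, Ne.symm hab, Ne.symm hac]
  have hρmα : (Finsupp.single α p : Expo →₀ ℕ) α = p := by simp
  have hρpβ : (Finsupp.single β q + Finsupp.single γ r) β = q := by
    simp [Finsupp.single_apply, Ne.symm hbc]
  have hρmβ : (Finsupp.single α p : Expo →₀ ℕ) β = 0 := by simp [Finsupp.single_apply, hab]
  have hρpγ : (Finsupp.single β q + Finsupp.single γ r) γ = r := by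
    simp [Finsupp.single_apply, hbc]
  have hρmγ : (Finsupp.single α p : Expo →₀ ℕ) γ = 0 := by simp [Finsupp.single_apply, hac]
  have hPT : PermType (fun j => (u j).support ∪ (v j).support) →
      S.card ≤ 2 ^ (c * m) * ((tailSupport u v).card + 2) ^ c := fun hperm =>
    calc S.card ≤ 2 ^ (13 * m) * ((tailSupport u v).card + 2) ^ 2 := permTypeLaw_proof m u v hu hv hperm S hS
      _ ≤ 2 ^ (c * m) * ((tailSupport u v).card + 2) ^ c := hc2 m _
  by_cases hlarge : m < q ∨ m < r ∨ m < p
  · -- a coefficient exceeds `m`: permutation type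
    apply hPT
    rcases hlarge with hql | hrl | hpl
    · exact R7a.permType_of_rankOne_largeCoeff _ _ _ β hR (Or.inl ⟨by rw [hρpβ]; exact hql, hρmβ⟩)
    · exact R7a.permType_of_rankOne_largeCoeff _ _ _ γ hR (Or.inl ⟨by rw [hρpγ]; exact hrl, hρmγ⟩)
    · exact R7a.permType_of_rankOne_largeCoeff _ _ _ α hR (Or.inr ⟨by rw [hρmα]; exact hpl, hρpα⟩)
  have hqm : q ≤ m := by omega
  have hrm : r ≤ m := by omega
  have hpm : p ≤ m := by omega
  by_cases hall : α ∈ tailSupport u v ∧ β ∈ tailSupport u v ∧ γ ∈ tailSupport u v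
  · obtain ⟨hα, hβ, hγ⟩ := hall
    let Dg : RelData u v := ⟨α, β, γ, q, r, p, hq, hp, hα, hβ, hγ, hab, hac, hbc, hrel⟩
    have h := (Dg.count hu hv hqm hrm hpm hR S hS).trans (hc1 m (sE u v) hm)
    exact h
  · -- an absent relation letter: permutation type
    apply hPT
    have hex : ∃ e : Expo, (e = α ∨ e = β ∨ e = γ) ∧ e ∉ tailSupport u v := by
      simp only [not_and_or] at hall
      rcases hall with h | h | h
      exacts [⟨α, Or.inl rfl, h⟩, ⟨β, Or.inr (Or.inl rfl), h⟩, ⟨γ, Or.inr (Or.inr rfl), h⟩]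
    obtain ⟨e, he, hnot⟩ := hex
    have hnotj : ∀ j, e ∉ (u j).support ∪ (v j).support := by
      intro j hj
      apply hnot
      rcases Finset.mem_union.mp hj with h | h
      · exact support_u_subset u v j h
      · exact support_v_subset u v j h
    rcases he with rfl | rfl | rfl
    · exact R7a.permType_of_rankOne_absent _ _ _ e hR (Or.inr ⟨by rw [hρmα]; exact hp, hρpα⟩) hnotj
    · exact R7a.permType_of_rankOne_absent _ _ _ e hR (Or.inl ⟨by rw [hρpβ]; exact hq, hρmβ⟩) hnotj
    · exact R7a.permType_of_rankOne_absent _ _ _ e hR (Or.inl ⟨by rw [hρpγ]; exact hr, hρmγ⟩) hnotj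

/-! ### Corollaries: the earlier three-letter rungs are instances -/

/-- `p = 1`: R7a's hypothesis shape (`α = qβ + rγ`, `RankOneCoincidences A (qβ + rγ) (α)`). [folklore] -/
theorem visible_bound_free (c : ℕ) (hc : ∀ (m : ℕ) (u v : Fin m → MvPolynomial (Fin 2) ℂ), (∀ j, coeff 0 (u j) = 0) →
      (∀ j, coeff 0 (v j) = 0) →
      (∃ (α β γ : Expo) (p q r : ℕ), 1 ≤ p ∧ 1 ≤ q ∧ 1 ≤ r ∧ α ≠ β ∧ α ≠ γ ∧ β ≠ γ ∧ p • α = q • β + r • γ ∧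
        RankOneCoincidences (fun j => (u j).support ∪ (v j).support)
          (Finsupp.single β q + Finsupp.single γ r) (Finsupp.single α p)) →
      ∀ S : Finset Expo, (∀ l ∈ S, ∃ ξ : Fin 2 → ℝ, ValidWeight u v ξ ∧ IsStrictTop ξ ↑(tailDiff u v).support l) →
        S.card ≤ 2 ^ (c * m) * ((tailSupport u v).card + 2) ^ c)
    (m : ℕ) (u v : Fin m → MvPolynomial (Fin 2) ℂ) (hu : ∀ j, coeff 0 (u j) = 0) (hv : ∀ j, coeff 0 (v j) = 0)
    (h : ∃ (α β γ : Expo) (q r : ℕ), 1 ≤ q ∧ 1 ≤ r ∧ α ≠ β ∧ α ≠ γ ∧ β ≠ γ ∧ α = q • β + r • γ ∧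
      RankOneCoincidences (fun j => (u j).support ∪ (v j).support)
        (Finsupp.single β q + Finsupp.single γ r) (Finsupp.single α 1))
    (S : Finset Expo) (hS : ∀ l ∈ S, ∃ ξ : Fin 2 → ℝ, ValidWeight u v ξ ∧ IsStrictTop ξ ↑(tailDiff u v).support l) :
    S.card ≤ 2 ^ (c * m) * ((tailSupport u v).card + 2) ^ c := by
  obtain ⟨α, β, γ, q, r, hq, hr, hab, hac, hbc, hrel, hR⟩ := h
  exact hc m u v hu hv ⟨α, β, γ, 1, q, r, le_refl 1, hq, hr, hab, hac, hbc, by rw [one_nsmul]; exact hrel, hR⟩ S hS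

/-- `p = q + r` (homogeneous, val-lit-p3 g15's R6d shape `qα' + rγ' = (q+r)β'`, `RankOneCoincidences A ((q+r)β') (qα' + rγ')`):
an instance with the roles `α ↦ β', β ↦ α', γ ↦ γ'`. [folklore] -/
theorem visible_bound_hom (c : ℕ) (hc : ∀ (m : ℕ) (u v : Fin m → MvPolynomial (Fin 2) ℂ), (∀ j, coeff 0 (u j) = 0) →
      (∀ j, coeff 0 (v j) = 0) →
      (∃ (α β γ : Expo) (p q r : ℕ), 1 ≤ p ∧ 1 ≤ q ∧ 1 ≤ r ∧ α ≠ β ∧ α ≠ γ ∧ β ≠ γ ∧ p • α = q • β + r • γ ∧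
        RankOneCoincidences (fun j => (u j).support ∪ (v j).support)
          (Finsupp.single β q + Finsupp.single γ r) (Finsupp.single α p)) →
      ∀ S : Finset Expo, (∀ l ∈ S, ∃ ξ : Fin 2 → ℝ, ValidWeight u v ξ ∧ IsStrictTop ξ ↑(tailDiff u v).support l) →
        S.card ≤ 2 ^ (c * m) * ((tailSupport u v).card + 2) ^ c)
    (m : ℕ) (u v : Fin m → MvPolynomial (Fin 2) ℂ) (hu : ∀ j, coeff 0 (u j) = 0) (hv : ∀ j, coeff 0 (v j) = 0)
    (h : ∃ α β γ : Expo, ∃ q r : ℕ, α ≠ β ∧ α ≠ γ ∧ β ≠ γ ∧ 1 ≤ q ∧ 1 ≤ r ∧ q • α + r • γ = (q + r) • β ∧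
      RankOneCoincidences (fun j => (u j).support ∪ (v j).support)
        (Finsupp.single β (q + r)) (Finsupp.single α q + Finsupp.single γ r))
    (S : Finset Expo) (hS : ∀ l ∈ S, ∃ ξ : Fin 2 → ℝ, ValidWeight u v ξ ∧ IsStrictTop ξ ↑(tailDiff u v).support l) :
    S.card ≤ 2 ^ (c * m) * ((tailSupport u v).card + 2) ^ c := by
  obtain ⟨α, β, γ, q, r, hab, hac, hbc, hq, hr, hrel, hR⟩ := h
  exact hc m u v hu hv ⟨β, α, γ, q + r, q, r, by omega, hq, hr, Ne.symm hab, hbc, hac, hrel.symm, R6c.rankOneCoincidences_symm _ _ _ hR⟩ S hS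


/-! ### Rung R7c: rank one on TWO letters with torsion `p α = q β` — the `r = 0` instance with an idle third letter -/

/-- Planar support points of the difference of products are sums of letter tuples of the family. [folklore] -/
theorem exists_tuple_of_mem_support_tailDiff (hu : ∀ j, coeff 0 (u j) = 0) (hv : ∀ j, coeff 0 (v j) = 0) (n : Expo)
    (hn : n ∈ (tailDiff u v).support) :
    ∃ a ∈ tuples (fun j => (u j).support ∪ (v j).support), ∑ j, a j = n := by
  classical
  set A : Fin m → Finset Expo := fun j => (u j).support ∪ (v j).support with hA
  have hcU : ∀ j i, cU u v j i ≠ 0 → enum u v i ∈ A j := fun j i h =>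
    Finset.mem_union_left _ (mem_support_iff.mpr h)
  have hcV : ∀ j i, cV u v j i ≠ 0 → enum u v i ∈ A j := fun j i h =>
    Finset.mem_union_right _ (mem_support_iff.mpr h)
  have hn' : n ∈ (phi (enum u v) (liftG (cU u v) (cV u v))).support := by
    rw [phi_liftG]; exact hn
  obtain ⟨κ, hκ, hπ⟩ := exists_of_mem_support_phi (enum u v) _ n hn'
  unfold liftG at hκ
  rcases Finset.mem_union.1 (support_sub _ _ _ hκ) with h | h
  · obtain ⟨a, ha, hs, -⟩ := tuple_of_mem_support_prod u v hu hv A (cU u v) hcU κ h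
    exact ⟨a, ha, hs.trans hπ⟩
  · obtain ⟨a, ha, hs, -⟩ := tuple_of_mem_support_prod u v hu hv A (cV u v) hcV κ h
    exact ⟨a, ha, hs.trans hπ⟩

/-- A tail alphabet inside `{α, β}`: at most `3^m` letter tuples, hence at most `3^m` support points. [folklore] -/
theorem card_le_of_subset_pair (hu : ∀ j, coeff 0 (u j) = 0) (hv : ∀ j, coeff 0 (v j) = 0) (α β : Expo)
    (hT : tailSupport u v ⊆ {α, β}) (S : Finset Expo) (hS : ∀ l ∈ S, l ∈ (tailDiff u v).support) :
    S.card ≤ 3 ^ m := by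
  classical
  set A : Fin m → Finset Expo := fun j => (u j).support ∪ (v j).support with hA
  have hAj : ∀ j, A j ⊆ {α, β} := fun j e he => by
    apply hT
    rcases Finset.mem_union.1 he with h | h
    · exact support_u_subset u v j h
    · exact support_v_subset u v j h
  have himg : S ⊆ (tuples A).image (fun a => ∑ j, a j) := fun l hl => by
    obtain ⟨a, ha, hsum⟩ := exists_tuple_of_mem_support_tailDiff hu hv l (hS l hl)
    exact Finset.mem_image.2 ⟨a, ha, hsum⟩
  have h2 : ({α, β} : Finset Expo).card ≤ 2 := Finset.card_le_two
  have h3 : ∀ j, (insert (0 : Expo) (A j)).card ≤ 3 := fun j =>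
    (Finset.card_insert_le _ _).trans (by have := (Finset.card_le_card (hAj j)).trans h2; omega)
  calc S.card ≤ ((tuples A).image fun a => ∑ j, a j).card := Finset.card_le_card himg
    _ ≤ (tuples A).card := Finset.card_image_le
    _ = ∏ j, (insert (0 : Expo) (A j)).card := by unfold tuples; exact Fintype.card_piFinset _
    _ ≤ ∏ _j : Fin m, 3 := Finset.prod_le_prod (fun _ _ => Nat.zero_le _) fun j _ => h3 j
    _ = 3 ^ m := by simp


omit [Fintype σ] [DecidableEq σ] in
/-- **R7c — RANK ONE ON TWO LETTERS WITH TORSION, UNCONDITIONAL** (val-idea-8 g3's `rankOneTwoLaw : RankOneTwoLaw`): if ALL additive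
coincidences of the letter family come from ONE relation `p α = q β` between two distinct letters (`p, q ≥ 1`), then GLOBALLY
`#visible ≤ 2^{c m} (#T + 2)^c` (the `r = 0` instance of the R7b engine with ANY third tail letter as an idle dummy; a tail alphabet inside
`{α, β}` has at most `3^m` visible points).  PORT DELTA: literal body instead of the source's parameter-free `def RankOneTwoLaw : Prop`. [folklore] -/
theorem rankOneTwoLaw_proof :
  ∃ c : ℕ, ∀ (m : ℕ) (u v : Fin m → MvPolynomial (Fin 2) ℂ), (∀ j, coeff 0 (u j) = 0) → (∀ j, coeff 0 (v j) = 0) →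
    (∃ (α β : Expo) (p q : ℕ), 1 ≤ p ∧ 1 ≤ q ∧ α ≠ β ∧ p • α = q • β ∧
      RankOneCoincidences (fun j => (u j).support ∪ (v j).support) (Finsupp.single β q) (Finsupp.single α p)) →
    ∀ S : Finset Expo, (∀ l ∈ S, ∃ ξ : Fin 2 → ℝ, ValidWeight u v ξ ∧ IsStrictTop ξ ↑(tailDiff u v).support l) →
      S.card ≤ 2 ^ (c * m) * ((tailSupport u v).card + 2) ^ c := by

  classical
  obtain ⟨c, hc1, hc2⟩ := arith_R7b
  refine ⟨c, fun m u v hu hv hrel S hS => ?_⟩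
  obtain ⟨α, β, p, q, hp, hq, hab, hrel, hR⟩ := hrel
  rcases S.eq_empty_or_nonempty with hSe | hSne
  · simp [hSe]
  obtain ⟨l₀, hl₀⟩ := hSne
  obtain ⟨ξ₀, hval₀, htop₀⟩ := hS l₀ hl₀
  have hm : 1 ≤ m := by
    rcases Nat.eq_zero_or_pos m with h | h
    · exfalso
      subst h
      apply mem_support_iff.mp htop₀.1
      unfold tailDiff
      simp
    · exact h
  have hρpα : (Finsupp.single β q : Expo →₀ ℕ) α = 0 := by simp [Finsupp.single_apply, Ne.symm hab]
  have hρmα : (Finsupp.single α p : Expo →₀ ℕ) α = p := by simp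
  have hρpβ : (Finsupp.single β q : Expo →₀ ℕ) β = q := by simp
  have hρmβ : (Finsupp.single α p : Expo →₀ ℕ) β = 0 := by simp [Finsupp.single_apply, hab]
  have hPT : PermType (fun j => (u j).support ∪ (v j).support) →
      S.card ≤ 2 ^ (c * m) * ((tailSupport u v).card + 2) ^ c := fun hperm =>
    calc S.card ≤ 2 ^ (13 * m) * ((tailSupport u v).card + 2) ^ 2 := permTypeLaw_proof m u v hu hv hperm S hS
      _ ≤ 2 ^ (c * m) * ((tailSupport u v).card + 2) ^ c := hc2 m _
  by_cases hlarge : m < q ∨ m < p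
  · apply hPT
    rcases hlarge with hql | hpl
    · exact R7a.permType_of_rankOne_largeCoeff _ _ _ β hR (Or.inl ⟨by rw [hρpβ]; exact hql, hρmβ⟩)
    · exact R7a.permType_of_rankOne_largeCoeff _ _ _ α hR (Or.inr ⟨by rw [hρmα]; exact hpl, hρpα⟩)
  have hqm : q ≤ m := by omega
  have hpm : p ≤ m := by omega
  have habsent : ∀ e : Expo, (e = α ∨ e = β) → e ∉ tailSupport u v →
      PermType (fun j => (u j).support ∪ (v j).support) := by
    intro e he hnot
    have hnotj : ∀ j, e ∉ (u j).support ∪ (v j).support := by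
      intro j hj
      apply hnot
      rcases Finset.mem_union.mp hj with h | h
      · exact support_u_subset u v j h
      · exact support_v_subset u v j h
    rcases he with rfl | rfl
    · exact R7a.permType_of_rankOne_absent _ _ _ e hR (Or.inr ⟨by rw [hρmα]; exact hp, hρpα⟩) hnotj
    · exact R7a.permType_of_rankOne_absent _ _ _ e hR (Or.inl ⟨by rw [hρpβ]; exact hq, hρmβ⟩) hnotj
  by_cases hαT : α ∈ tailSupport u v
  swap
  · exact hPT (habsent α (Or.inl rfl) hαT)
  by_cases hβT : β ∈ tailSupport u v
  swap
  · exact hPT (habsent β (Or.inr rfl) hβT)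
  by_cases h3 : ∃ γ ∈ tailSupport u v, γ ≠ α ∧ γ ≠ β
  · -- an idle third tail letter: the `r = 0` instance of the engine
    obtain ⟨γ, hγ, hca, hcb⟩ := h3
    let Dg : RelData u v := ⟨α, β, γ, q, 0, p, hq, hp, hαT, hβT, hγ, hab, Ne.symm hca, Ne.symm hcb,
      by rw [zero_nsmul, add_zero]; exact hrel⟩
    have hR' : RankOneCoincidences (fun j => (u j).support ∪ (v j).support)
        (Finsupp.single Dg.β Dg.q + Finsupp.single Dg.γ Dg.r) (Finsupp.single Dg.α Dg.p) := by
      show RankOneCoincidences _ (Finsupp.single β q + Finsupp.single γ 0) (Finsupp.single α p)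
      rw [Finsupp.single_zero, add_zero]
      exact hR
    have h := (Dg.count hu hv hqm (Nat.zero_le m) hpm hR' S hS).trans (hc1 m (sE u v) hm)
    exact h
  · -- the tail alphabet lies inside `{α, β}`
    have hT : tailSupport u v ⊆ {α, β} := by
      intro e he
      rw [Finset.mem_insert, Finset.mem_singleton]
      by_contra hne
      push Not at hne
      exact h3 ⟨e, he, hne.1, hne.2⟩
    have h1 := card_le_of_subset_pair hu hv α β hT S fun l hl => by
      obtain ⟨ξ, -, htop⟩ := hS l hl
      exact Finset.mem_coe.1 htop.1
    have h34 : 3 ^ m ≤ 2 ^ (13 * m) := by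
      calc 3 ^ m ≤ 4 ^ m := Nat.pow_le_pow_left (by norm_num) m
        _ = 2 ^ (2 * m) := by rw [pow_mul]; norm_num
        _ ≤ 2 ^ (13 * m) := Nat.pow_le_pow_right (by norm_num) (by omega)
    have hs1 : 1 ≤ ((tailSupport u v).card + 2) ^ 2 := Nat.one_le_pow _ _ (by omega)
    calc S.card ≤ 3 ^ m := h1
      _ ≤ 2 ^ (13 * m) * ((tailSupport u v).card + 2) ^ 2 := by
          calc 3 ^ m ≤ 2 ^ (13 * m) * 1 := by rw [mul_one]; exact h34
            _ ≤ 2 ^ (13 * m) * ((tailSupport u v).card + 2) ^ 2 := Nat.mul_le_mul_left _ hs1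
      _ ≤ 2 ^ (c * m) * ((tailSupport u v).card + 2) ^ c := hc2 m _

end FreeCount

end R7b
end Summit.ValiantsHypothesis.ValiantsHypothesis.Theorems.NewtonUnitEquations.TwoProducts.PermutationType

end
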